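import Summits.AtomisticToContinuum.Crystallization.Theorems.FrustratedLawDichotomyStrainedPatchHomSlopeLJAffine2Kit

/-!
# K1-v2 kernel, FAST ARRAY: the cross-label quadratic array assembled from THREE label-accumulated tensors (kernel cost ÷ 12)
# (27623 `(H) HomFloor (1/625)`, hcp half; hand-1 g34 FINDING §4)

decomp-a2c hand-1 g34 (crux `AperiodicFrustratedLawGap`, stmt-AtomisticToContinuum-27623).  `…HomSlopeLJAffine2Kit.QarrLJA2 i a a'` re-runs the label loop for
each of the `243` index triples (`≈ 1.5·10⁶` interval products per chunk; seat kernel probes D1–D4 did not return within 600 s).  Since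
`M_b,k,a = δ_{k,a.1}(w_b)_{a.2} + cJr_k,a` and `cJr` does NOT depend on the label, the array splits as
`Q_i[a,a'] = W2[a.2,a'.2,a.1,a'.1] + Σ_k' cJr_k',a' W1[a.2,a.1,k'] + Σ_k cJr_k,a W1[a'.2,k,a'.1] + Σ_kk' cJr_k,a cJr_k',a' T0[k,k']` with the label sums
`T0 = Σ_b Dreal_b`, `W1[l] = Σ_b (w_b)_l Dreal_b`, `W2[l,l'] = Σ_b (w_b)_l (w_b)_l' Dreal_b` (`27 + 81 + 243` accumulations, `≈ 1.2·10⁵` products):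
`T0arr/W1arr/W2arr`, ★ `QarrLJA2F`, ★ `mem_QarrLJA2F` (encloses the same real array `Σ_b Σ_kk' Mre Mre Dreal`), `quadVec2F/quadL2F`, ★ `slopeCheckLJA2F`,
`slopeGsLJA2F`, `slopeCheckLJA2F_slopeGsLJA2F`.  Soundness: `…HomSlopeLJAffine2F`.

Kernel definitions + enclosure lemma; 0 sorry; standard axioms; no instances / notation / `#eval`.  `--supports stmt-AtomisticToContinuum-27623`.
-/

noncomputable section

namespace Summit.AtomisticToContinuum.Crystallization.Theorems.FrustratedLawDichotomyStrainedPatchHomSlopeLJAffine2Kit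

open scoped BigOperators RealInnerProductSpace
open Literature.Analysis.ValidatedNumerics.Numerics
open Summit.AtomisticToContinuum.Crystallization.Theorems.ChargedEnergyGapNegative (E3)
open Summit.AtomisticToContinuum.Crystallization.Theorems.FrustratedLawDichotomyStrainedPatchHomCurvKit (accFI mem_accFI)
open Summit.AtomisticToContinuum.Crystallization.Theorems.FrustratedLawDichotomyStrainedPatchHomCurvCentreKit
open Summit.AtomisticToContinuum.Crystallization.Theorems.FrustratedLawDichotomyStrainedPatchHomCurvLeafL (dflt3)
open Summit.AtomisticToContinuum.Crystallization.Theorems.FrustratedLawDichotomyStrainedPatchHomCurvLJ (recLJ ljLabelOK naiveLJ)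
open Summit.AtomisticToContinuum.Crystallization.Theorems.FrustratedLawDichotomyStrainedPatchHomSlopeLJ
open Summit.AtomisticToContinuum.Crystallization.Theorems.FrustratedLawDichotomyStrainedPatchHomSlopeLJAffine

/-- `T0[k,k',i] = Σ_b Dreal_b(k,k',i)`. -/
def T0arr (c w' : (Fin 3 × Fin 3) ⊕ Fin 3 → ℤ) (Lc : List (Fin 3 → ℤ)) (k k' i : Fin 3) : FI := accFI Lc fun b => Darr (recLJ c w' b) k k' i
/-- `W1[l,k,k',i] = Σ_b (w_b)_l Dreal_b(k,k',i)`. -/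
def W1arr (c w' : (Fin 3 × Fin 3) ⊕ Fin 3 → ℤ) (Lc : List (Fin 3 → ℤ)) (l k k' i : Fin 3) : FI :=
  accFI Lc fun b => (wVec c b l).mul (Darr (recLJ c w' b) k k' i)
/-- `W2[l,l',k,k',i] = Σ_b (w_b)_l (w_b)_l' Dreal_b(k,k',i)`. -/
def W2arr (c w' : (Fin 3 × Fin 3) ⊕ Fin 3 → ℤ) (Lc : List (Fin 3 → ℤ)) (l l' k k' i : Fin 3) : FI :=
  accFI Lc fun b => (wVec c b l).mul ((wVec c b l').mul (Darr (recLJ c w' b) k k' i))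
/-- Sum of three intervals. -/
def sum3 (f : Fin 3 → FI) : FI := ((f 0).add (f 1)).add (f 2)

/-- `sum3` encloses the sum. [folklore] -/
theorem mem_sum3 {g : Fin 3 → ℝ} {f : Fin 3 → FI} (h : ∀ k, FI.mem (g k) (f k)) : FI.mem (∑ k : Fin 3, g k) (sum3 f) := by
  simp only [Fin.sum_univ_three, sum3]; exact FI.mem_add (FI.mem_add (h 0) (h 1)) (h 2)

/-- ★ **THE FAST CROSS-LABEL QUADRATIC ARRAY** (same real array as `QarrLJA2`, assembled from `T0arr/W1arr/W2arr`). -/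
def QarrLJA2F (c w : (Fin 3 × Fin 3) ⊕ Fin 3 → ℤ) (J : Fin 3 → Fin 3 × Fin 3 → ℤ) (Lc : List (Fin 3 → ℤ)) (i : Fin 3) (a a' : Fin 3 × Fin 3) : FI :=
  (((W2arr c (hullW J w) Lc a.2 a'.2 a.1 a'.1 i).add (sum3 fun k' => (cJ c J k' a').mul (W1arr c (hullW J w) Lc a.2 a.1 k' i))).add
    (sum3 fun k => (cJ c J k a).mul (W1arr c (hullW J w) Lc a'.2 k a'.1 i))).add
    (sum9 fun k k' => (cJ c J k a).mul ((cJ c J k' a').mul (T0arr c (hullW J w) Lc k k' i)))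

/-- Kronecker collapse over `Fin 3`. [arithmetic] -/
theorem kron1 (p : Fin 3) (x : ℝ) (f : Fin 3 → ℝ) : ∑ k : Fin 3, (if k = p then x else 0) * f k = x * f p := by
  rw [Finset.sum_eq_single p (fun k _ hk => by rw [if_neg hk, zero_mul]) (fun h => absurd (Finset.mem_univ p) h), if_pos rfl]

/-- ★ **`QarrLJA2F` encloses the cross-label quadratic array** `Σ_b Σ_kk' Mre_b,k,a Mre_b,k',a' T_b(k,k')` for any per-label tensors `T_b` enclosed by
`Darr (recLJ …)`. [arithmetic: split `Mre = δ·w + cJr`, collapse the Kronecker sums, pull the label-independent `cJr` out of the label sums] -/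
theorem mem_QarrLJA2F {c w : (Fin 3 × Fin 3) ⊕ Fin 3 → ℤ} {J : Fin 3 → Fin 3 × Fin 3 → ℤ} {Lc : List (Fin 3 → ℤ)} (hLc : Lc.Nodup) {i : Fin 3}
    {T : (Fin 3 → ℤ) → Fin 3 → Fin 3 → ℝ} (hT : ∀ b ∈ Lc, ∀ k k', FI.mem (T b k k') (Darr (recLJ c (hullW J w) b) k k' i)) (a a' : Fin 3 × Fin 3) :
    FI.mem (∑ b ∈ Lc.toFinset, ∑ k : Fin 3, ∑ k' : Fin 3, Mre c J b k a * Mre c J b k' a' * T b k k') (QarrLJA2F c w J Lc i a a') := by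
  classical
  -- split the per-label double sum into the four pieces (Kronecker collapse by a `Fin 3` case split)
  have hsplit : ∀ b, ∑ k : Fin 3, ∑ k' : Fin 3, Mre c J b k a * Mre c J b k' a' * T b k k' =
      wPt c b a.2 * (wPt c b a'.2 * T b a.1 a'.1) +
      ∑ k' : Fin 3, cJr c J k' a' * (wPt c b a.2 * T b a.1 k') +
      ∑ k : Fin 3, cJr c J k a * (wPt c b a'.2 * T b k a'.1) +
      ∑ k : Fin 3, ∑ k' : Fin 3, cJr c J k a * (cJr c J k' a' * T b k k') := by
    intro b
    have e : ∀ k k', Mre c J b k a * Mre c J b k' a' * T b k k' =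
        (if k = a.1 then wPt c b a.2 else 0) * ((if k' = a'.1 then wPt c b a'.2 else 0) * T b k k') +
        (if k = a.1 then wPt c b a.2 else 0) * (cJr c J k' a' * T b k k') +
        cJr c J k a * ((if k' = a'.1 then wPt c b a'.2 else 0) * T b k k') + cJr c J k a * (cJr c J k' a' * T b k k') := by
      intro k k'; simp only [Mre]; ring
    simp only [e, Finset.sum_add_distrib]
    congr 1
    congr 1
    congr 1
    · rw [Finset.sum_congr rfl fun k _ => by rw [← Finset.mul_sum, kron1], kron1]
    · rw [Finset.sum_congr rfl fun k _ => by rw [← Finset.mul_sum], kron1, Finset.mul_sum]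
      exact Finset.sum_congr rfl fun k' _ => by ring
    · refine Finset.sum_congr rfl fun k _ => ?_
      rw [← Finset.mul_sum, kron1]
  rw [Finset.sum_congr rfl fun b _ => hsplit b, Finset.sum_add_distrib, Finset.sum_add_distrib, Finset.sum_add_distrib]
  unfold QarrLJA2F
  refine FI.mem_add (FI.mem_add (FI.mem_add ?_ ?_) ?_) ?_
  · exact mem_accFI Lc hLc fun b hb => FI.mem_mul (mem_wVec c b a.2) (FI.mem_mul (mem_wVec c b a'.2) (hT b hb a.1 a'.1))
  · rw [Finset.sum_comm]
    refine mem_sum3 fun k' => ?_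
    rw [← Finset.mul_sum]
    exact FI.mem_mul (mem_cJ c J k' a') (mem_accFI Lc hLc fun b hb => FI.mem_mul (mem_wVec c b a.2) (hT b hb a.1 k'))
  · rw [Finset.sum_comm]
    refine mem_sum3 fun k => ?_
    rw [← Finset.mul_sum]
    exact FI.mem_mul (mem_cJ c J k a) (mem_accFI Lc hLc fun b hb => FI.mem_mul (mem_wVec c b a'.2) (hT b hb k a'.1))
  · have e4 : ∑ b ∈ Lc.toFinset, ∑ k : Fin 3, ∑ k' : Fin 3, cJr c J k a * (cJr c J k' a' * T b k k') =
        ∑ k : Fin 3, ∑ k' : Fin 3, ∑ b ∈ Lc.toFinset, cJr c J k a * (cJr c J k' a' * T b k k') := by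
      rw [Finset.sum_comm]; exact Finset.sum_congr rfl fun k _ => Finset.sum_comm
    rw [e4]
    refine mem_sum9 fun k k' => ?_
    rw [← Finset.mul_sum, ← Finset.mul_sum]
    exact FI.mem_mul (mem_cJ c J k a) (FI.mem_mul (mem_cJ c J k' a') (mem_accFI Lc hLc fun b hb => hT b hb k k'))

/-- Scaled componentwise bound of half the quadratic term (fast array). -/
def quadVec2F (c w : (Fin 3 × Fin 3) ⊕ Fin 3 → ℤ) (J : Fin 3 → Fin 3 × Fin 3 → ℤ) (Lc : List (Fin 3 → ℤ)) (i : Fin 3) : ℤ :=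
  cdiv (∑ a : Fin 3 × Fin 3, ∑ a' : Fin 3 × Fin 3, cdiv (w (Sum.inl a) * w (Sum.inl a')) SC * (QarrLJA2F c w J Lc i a a').absHi + resQ c w J Lc i) (2 * SC)
/-- Scaled `ℓ²` bound of half the quadratic term (fast array). -/
def quadL2F (c w : (Fin 3 × Fin 3) ⊕ Fin 3 → ℤ) (J : Fin 3 → Fin 3 × Fin 3 → ℤ) (Lc : List (Fin 3 → ℤ)) : ℤ :=
  (FI.sqrt ⟨0, cdiv (∑ i : Fin 3, quadVec2F c w J Lc i ^ 2) SC⟩).hi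
/-- ★ **THE SECOND-ORDER CENTRED AFFINE LJ SLOPE CHECK, FAST ARRAY.** -/
def slopeCheckLJA2F (c w : (Fin 3 × Fin 3) ⊕ Fin 3 → ℤ) (J : Fin 3 → Fin 3 × Fin 3 → ℤ) (Lc Ln : List (Fin 3 → ℤ)) (Gs : ℤ) : Bool :=
  (Lc.all fun b => ljLabelOK c (hullW J w) b) && (Ln.all fun b => (naiveLJ c (hullW J w) b).isSome) &&
    decide (g0LJ c Lc + linLJA c w J Lc + quadL2F c w J Lc + rem3LJ c (hullW J w) Lc + naiSLJ c (hullW J w) Ln ≤ Gs)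
/-- The computed bound (fast array). -/
def slopeGsLJA2F (c w : (Fin 3 × Fin 3) ⊕ Fin 3 → ℤ) (J : Fin 3 → Fin 3 × Fin 3 → ℤ) (Lc Ln : List (Fin 3 → ℤ)) : ℤ :=
  g0LJ c Lc + linLJA c w J Lc + quadL2F c w J Lc + rem3LJ c (hullW J w) Lc + naiSLJ c (hullW J w) Ln
/-- `slopeCheckLJA2F` passes at the computed bound, given the guards. [formal bookkeeping] -/
theorem slopeCheckLJA2F_slopeGsLJA2F {c w : (Fin 3 × Fin 3) ⊕ Fin 3 → ℤ} {J : Fin 3 → Fin 3 × Fin 3 → ℤ} {Lc Ln : List (Fin 3 → ℤ)}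
    (hc : (Lc.all fun b => ljLabelOK c (hullW J w) b) = true) (hn : (Ln.all fun b => (naiveLJ c (hullW J w) b).isSome) = true) :
    slopeCheckLJA2F c w J Lc Ln (slopeGsLJA2F c w J Lc Ln) = true := by
  unfold slopeCheckLJA2F slopeGsLJA2F
  simp only [Bool.and_eq_true, decide_eq_true_eq]
  exact ⟨⟨hc, hn⟩, le_rfl⟩

end Summit.AtomisticToContinuum.Crystallization.Theorems.FrustratedLawDichotomyStrainedPatchHomSlopeLJAffine2Kit

end
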